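/-
Copyright: the b2b-balaban cell (near-miss cell 7), T⁴-continuum fan-out, NE7b ROUND-2 swarm `t4-ne7b-formalise-*`
(seat leaf-01), row S6 «H2d zones» of lineage t4-ne7b-p1's claim table `LEAVES-NE7b.md` — TH re-target (R-OWNER-22-1).
Released under the licence of the surrounding project.
-/
import Summits.QuantumFields.BalabanUV.T4Continuum.Support.HistoryShapeCrowd

/-!
# History zones along a shape map, II: the zone READING of a tagged genealogy ⇒ dynamics, admissibility, multiplicity

Summits-side support leaf of the T⁴-continuum cell (rung (B)+1 on a FINITE torus only; NOT infinite volume, NOT the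
mass gap, NOT the Clay statement; NOT a proof of the spine estimate NE7b).  NE7b ROUND-2 swarm, row S6 (H2d) after
R-OWNER-22-1∕-22-3: the socket `HistorySocketTH` (R2) prices a TAGGED live genealogy `G′ : Gen ε` (shape map
`sh : ε → PEv`, tags distinct, shapes may repeat) with the multiplicity
`mult(G′) = Kz^{#merges G′}·∏_{e ∈ merges G′} Q(wcntS sh G′,σ,(sh e).step)^p·Λ′^{partnerAges (step∘sh) G′}`, which row S6
must JUSTIFY as a bound on the zone-admissible placements of `G′`.  This file is the verbatim transport along `sh` of
`Support/ZoneReading` §3–§5 (`sh = id` recovers it; `sh = Prod.fst` is row S3's `genT`); NOTHING asks the shapes to be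
distinct.  [folklore] bookkeeping over the lineage's OWN carriers; nothing is quoted from print, nothing printed is
asserted, no `[cite:]` tag, no `Prop` fact minted (`ZoneReadingS` is a HYPOTHESIS SHAPE, never asserted).

WHAT.  **`ZoneReadingS sh n L K Cb G zone`** (the six reading facts, events dated by `step ∘ sh`, birth weight
`wtPEv ∘ sh`); the guarded realized extent `extRS`; **`zoneDyn_of_readingS`** (⇒ `ZoneDyn (step∘sh) (wtPEv∘sh) σ Cb
extRS`); **`admZ_of_readingS`** (the realized placement is zone-admissible given (p1) root cells of root scale and (p2)
partners' root blocks in their zones); **`card_admZSet_le_of_readingS`** = `mult(G′)` above, via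
`HistoryShapeCrowd.card_admZSet_grestrict_le_of_dynS`.  Part IIb (`HistoryShapeRegions.lean`): the zone map
`regZoneS` read off the TAGGED births' regions, `BirthRegionsS`, (p1)(p2), the face-connected index model.  Part III
(`HistoryZonesLive.lean`, = S1b merged per R-OWNER-22-3 (3)): the realisation predicate on row S3's `Pedigree` and the
reading for `genT X`.  Displayed until row S6f: `NoDropInLife` (cells indexed by the step, not yet by the model scale).
Walls unchanged: (ID) G-ne7bp1g9-1 (H3), (E2)∕(R1) G-ne7bp1-1.  NE7b discharge: no date.

HONEST DEPENDENCY (cell): continuum YM on T⁴ ⇐ BetaPertH ∧ nine spine estimates (0/9 proved); BetaPertH ⇐ (D1) ∧ (D4)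
∧ CAP+tail; G-an2-4 gates asym, D1 and NE2/3/4.  This file changes none of it.
-/

open Finset
open Literature.MathematicalPhysics.QuantumFieldTheory.Balaban1983to89
open T4PersistenceDictionary T4PartnerMultiplicity
open Summit.QuantumFields.BalabanUV.T4Continuum.PlacementSkeleton
open Summit.QuantumFields.BalabanUV.T4Continuum.Crowding
open Summit.QuantumFields.BalabanUV.T4Continuum.ZoneSkeleton
open Summit.QuantumFields.BalabanUV.T4Continuum.ZoneCrowd
open Summit.QuantumFields.BalabanUV.T4Continuum.ZoneTorus

namespace Summit.QuantumFields.BalabanUV.T4Continuum.HistoryZones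

noncomputable section

variable {d : ℕ} {ε : Type*} [DecidableEq ε] (sh : ε → PEv)

/-! ## §1 The zone reading along a shape map; dynamics, admissibility, count -/

/-- **THE ZONE READING ALONG A SHAPE MAP** (`ZoneTorus.ZoneReading` with events dated by `step ∘ sh` and birth weight
`wtPEv ∘ sh`): zones in range; a birth's zone at its shape-step spans at most `Cb·wtPEv (sh b)`; at a merger's
shape-step the merged zone lies in the union of the partners' zones, which SHARE a block; one step later the zone lies
in the blocked zone; a renewal adds nothing. [folklore] -/
structure ZoneReadingS (n L K : ℕ) (Cb : ℝ) (G : Gen ε) (zone : ℕ → Gen ε → Finset (Fin d → ℕ)) : Prop where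
  /-- zones at step `t` live on `(ℤ∕nL^{K−t})^d` -/
  inRange : ∀ (t : ℕ) (X : Gen ε), Sub X G → InRange (n * L ^ (K - t)) (zone t X)
  /-- a birth's zone at its shape-step spans at most `Cb·wtPEv (sh b)` -/
  birth : ∀ (b : ε) (j : ℕ), Sub (Gen.born b j) G →
    (diam (n * L ^ (K - (sh b).step)) (zone (sh b).step (Gen.born b j)) : ℝ) ≤ Cb * wtPEv (sh b)
  /-- at the merger's shape-step the merged zone lies inside the union of the partners' zones -/
  union : ∀ (X Y : Gen ε) (e : ε), Sub (Gen.merge X Y e) G →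
    zone (sh e).step (Gen.merge X Y e) ⊆ zone (sh e).step X ∪ zone (sh e).step Y
  /-- … and the partners' zones share a block there -/
  overlap : ∀ (X Y : Gen ε) (e : ε), Sub (Gen.merge X Y e) G → ∃ z, z ∈ zone (sh e).step X ∧ z ∈ zone (sh e).step Y
  /-- one step later (up to the cutoff) the zone lies inside the blocked zone -/
  step : ∀ (X : Gen ε) (t : ℕ), Sub X G → ftime (PEv.step ∘ sh) X ≤ t → t + 1 ≤ K →
    zone (t + 1) X ⊆ blocks L (zone t X)
  /-- a renewal adds nothing to the zone -/
  renew : ∀ (X : Gen ε) (e : ε) (h t : ℕ), Sub (Gen.renew X e h) G → zone t (Gen.renew X e h) ⊆ zone t X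

section Ext

open scoped Classical

/-- the guarded realized extent along `sh` (diameter of `zone t X` for sub-structures formed by `t ≤ K`, else `0`)
[folklore] -/
def extRS (n L K : ℕ) (G : Gen ε) (zone : ℕ → Gen ε → Finset (Fin d → ℕ)) (t : ℕ) (X : Gen ε) : ℝ :=
  if Sub X G ∧ ftime (PEv.step ∘ sh) X ≤ t ∧ t ≤ K then (diam (n * L ^ (K - t)) (zone t X) : ℝ) else 0

omit [DecidableEq ε] in
/-- `extRS ≥ 0` [folklore] -/
theorem extRS_nonneg (n L K : ℕ) (G : Gen ε) (zone : ℕ → Gen ε → Finset (Fin d → ℕ)) (t : ℕ) (X : Gen ε) :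
    0 ≤ extRS sh n L K G zone t X := by
  unfold extRS; split_ifs <;> positivity

omit [DecidableEq ε] in
/-- the realized extent on the guard [folklore] -/
theorem extRS_of_guard {n L K : ℕ} {G : Gen ε} {zone : ℕ → Gen ε → Finset (Fin d → ℕ)} {t : ℕ} {X : Gen ε}
    (h1 : Sub X G) (h2 : ftime (PEv.step ∘ sh) X ≤ t) (h3 : t ≤ K) :
    extRS sh n L K G zone t X = (diam (n * L ^ (K - t)) (zone t X) : ℝ) := by
  simp [extRS, h1, h2, h3]

/-- **THE READING GIVES THE DYNAMICS (along `sh`).** [folklore] -/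
theorem zoneDyn_of_readingS {n L K : ℕ} (hL : 1 ≤ L) {Cb σ : ℝ} (hCb : 0 ≤ Cb) (hσL : 1 / (L : ℝ) ≤ σ ^ 2)
    {G : Gen ε} (hchr : Chrono (PEv.step ∘ sh) G) {zone : ℕ → Gen ε → Finset (Fin d → ℕ)}
    (hR : ZoneReadingS sh n L K Cb G zone) :
    ZoneDyn (PEv.step ∘ sh) (wtPEv ∘ sh) σ Cb (extRS sh n L K G zone) := by
  have h0 : ∀ t X, 0 ≤ extRS sh n L K G zone t X := extRS_nonneg sh n L K G zone
  refine ⟨fun b j => ?_, fun X Y e => ?_, fun X t hft => ?_, fun X e h t => ?_⟩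
  · show extRS sh n L K G zone (sh b).step (Gen.born b j) ≤ Cb * wtPEv (sh b)
    unfold extRS
    split_ifs with hg
    · exact hR.birth b j hg.1
    · exact mul_nonneg hCb (wtPEv_nonneg _)
  · show extRS sh n L K G zone (sh e).step (Gen.merge X Y e) ≤
      extRS sh n L K G zone (sh e).step X + extRS sh n L K G zone (sh e).step Y + 1
    by_cases hg : Sub (Gen.merge X Y e) G ∧ ftime (PEv.step ∘ sh) (Gen.merge X Y e) ≤ (sh e).step ∧ (sh e).step ≤ K
    · obtain ⟨hsub, -, hK⟩ := hg
      have hsX : Sub X G := Sub.trans (Sub.left Y e (Sub.refl X)) hsub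
      have hsY : Sub Y G := Sub.trans (Sub.right X e (Sub.refl Y)) hsub
      obtain ⟨hfX, hfY⟩ := ftime_le_of_chrono (PEv.step ∘ sh) (chrono_of_sub (PEv.step ∘ sh) hsub hchr)
      simp only [Function.comp_apply] at hfX hfY
      rw [extRS_of_guard sh (t := (sh e).step) hsub le_rfl hK, extRS_of_guard sh hsX hfX hK,
        extRS_of_guard sh hsY hfY hK]
      obtain ⟨z, hzX, hzY⟩ := hR.overlap X Y e hsub
      have h1 := diam_mono (m := n * L ^ (K - (sh e).step)) (hR.union X Y e hsub)
      have h2 := diam_union_le_of_overlap (hR.inRange _ X hsX) (hR.inRange _ Y hsY) hzX hzY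
      have h3 : (diam (n * L ^ (K - (sh e).step)) (zone (sh e).step (Gen.merge X Y e)) : ℝ) ≤
          diam (n * L ^ (K - (sh e).step)) (zone (sh e).step X) +
            diam (n * L ^ (K - (sh e).step)) (zone (sh e).step Y) := by
        exact_mod_cast h1.trans h2
      linarith
    · have : extRS sh n L K G zone (sh e).step (Gen.merge X Y e) = 0 := by rw [extRS, if_neg hg]
      rw [this]; linarith [h0 (sh e).step X, h0 (sh e).step Y]
  · by_cases hg : Sub X G ∧ ftime (PEv.step ∘ sh) X ≤ t + 1 ∧ t + 1 ≤ K
    · obtain ⟨hsub, -, hK⟩ := hg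
      have hK' : t ≤ K := Nat.le_of_succ_le hK
      rw [extRS_of_guard sh hsub (Nat.le_succ_of_le hft) hK, extRS_of_guard sh hsub hft hK']
      have hm : n * L ^ (K - t) = n * L ^ (K - (t + 1)) * L := by
        rw [mul_assoc, ← pow_succ]; congr 2; omega
      have h1 := diam_mono (m := n * L ^ (K - (t + 1))) (hR.step X t hsub hft hK)
      have h2 := diam_blocks_le_real hL (n * L ^ (K - (t + 1))) (zone t X)
      rw [← hm] at h2
      have hD : (0 : ℝ) ≤ diam (n * L ^ (K - t)) (zone t X) := Nat.cast_nonneg _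
      calc (diam (n * L ^ (K - (t + 1))) (zone (t + 1) X) : ℝ)
          ≤ diam (n * L ^ (K - (t + 1))) (blocks L (zone t X)) := by exact_mod_cast h1
        _ ≤ 1 / (L : ℝ) * diam (n * L ^ (K - t)) (zone t X) + 1 := h2
        _ ≤ σ ^ 2 * diam (n * L ^ (K - t)) (zone t X) + 1 := by nlinarith
    · have : extRS sh n L K G zone (t + 1) X = 0 := by rw [extRS, if_neg hg]
      rw [this]; nlinarith [h0 t X, sq_nonneg σ]
  · by_cases hg : Sub (Gen.renew X e h) G ∧ ftime (PEv.step ∘ sh) (Gen.renew X e h) ≤ t ∧ t ≤ K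
    · obtain ⟨hsub, hft, hK⟩ := hg
      have hsX : Sub X G := Sub.trans (Sub.renew e h (Sub.refl X)) hsub
      rw [extRS_of_guard sh hsub hft hK, extRS_of_guard sh hsX hft hK]
      exact_mod_cast diam_mono (hR.renew X e h t hsub)
    · have : extRS sh n L K G zone t (Gen.renew X e h) = 0 := by rw [extRS, if_neg hg]
      rw [this]; exact h0 t X

end Ext

section Adm

open scoped Classical

/-- **THE REALIZED PLACEMENT IS ZONE-ADMISSIBLE (along `sh`).**  `G : Gen ε` chronological for `step ∘ sh` with shapes
dated `≤ K`, read by `ZoneReadingS`, `G'` its finite-alphabet copy (`gmap val G' = G`); if `P₀` puts every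
sub-structure's root on a cell of its root scale (p1) and at every merger the partners' root blocks lie in their zones
(p2), then `AdmZ (nearT n L K) (extRS ∘ gmap val) ((step ∘ sh) ∘ val) G' P₀`. [folklore] -/
theorem admZ_of_readingS {n L K : ℕ} {Cb : ℝ} {G : Gen ε} (hchr : Chrono (PEv.step ∘ sh) G)
    (hK : ∀ e ∈ G.events, (sh e).step ≤ K) {zone : ℕ → Gen ε → Finset (Fin d → ℕ)}
    (hR : ZoneReadingS sh n L K Cb G zone) {E : Finset ε} {G' : Gen ↥E} (hG : gmap Subtype.val G' = G)
    (P₀ : ↥E → TCell d (n * L ^ K)) (hscale : ∀ X' : Gen ↥E, Sub X' G' → IsScale L X'.rootStep (P₀ X'.root))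
    (hroot : ∀ (X' Y' : Gen ↥E) (e' : ↥E), Sub (Gen.merge X' Y' e') G' →
      (fun i => (P₀ X'.root i).val / L ^ (sh e'.1).step) ∈ zone (sh e'.1).step (gmap Subtype.val X') ∧
      (fun i => (P₀ Y'.root i).val / L ^ (sh e'.1).step) ∈ zone (sh e'.1).step (gmap Subtype.val Y')) :
    AdmZ (nearT n L K) (fun t Z => extRS sh n L K G zone t (gmap Subtype.val Z)) ((PEv.step ∘ sh) ∘ Subtype.val)
      G' P₀ := by
  suffices h : ∀ X' : Gen ↥E, Sub X' G' →
      AdmZ (nearT n L K) (fun t Z => extRS sh n L K G zone t (gmap Subtype.val Z)) ((PEv.step ∘ sh) ∘ Subtype.val)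
        X' P₀ from h G' (Sub.refl _)
  intro X' hX'
  induction X' with
  | born b j => trivial
  | renew X e h ih => exact ih (Sub.trans (Sub.renew e h (Sub.refl X)) hX')
  | merge A B e ihA ihB =>
      have hsA : Sub A G' := Sub.trans (Sub.left B e (Sub.refl A)) hX'
      have hsB : Sub B G' := Sub.trans (Sub.right A e (Sub.refl B)) hX'
      refine ⟨ihA hsA, ihB hsB, ?_⟩
      have hsub : Sub (gmap Subtype.val (Gen.merge A B e)) G := hG ▸ sub_gmap Subtype.val hX'
      have hsubA : Sub (gmap Subtype.val A) G := hG ▸ sub_gmap Subtype.val hsA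
      have hsubB : Sub (gmap Subtype.val B) G := hG ▸ sub_gmap Subtype.val hsB
      have hchr' : Chrono (PEv.step ∘ sh) (Gen.merge (gmap Subtype.val A) (gmap Subtype.val B) e.1) :=
        chrono_of_sub (PEv.step ∘ sh) hsub hchr
      obtain ⟨hfA, hfB⟩ := ftime_le_of_chrono (PEv.step ∘ sh) hchr'
      simp only [Function.comp_apply] at hfA hfB
      have heK : (sh e.1).step ≤ K := hK e.1 (events_subset_of_sub hsub (by simp [gmap]))
      show nearT n L K (P₀ A.root) A.rootStep (P₀ B.root) B.rootStep (sh e.1).step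
        (extRS sh n L K G zone (sh e.1).step (gmap Subtype.val A) +
          extRS sh n L K G zone (sh e.1).step (gmap Subtype.val B))
      rw [extRS_of_guard sh hsubA hfA heK, extRS_of_guard sh hsubB hfB heK]
      obtain ⟨z, hzA, hzB⟩ := hR.overlap _ _ e.1 hsub
      obtain ⟨hrA, hrB⟩ := hroot A B e hX'
      exact nearT_of_mem_overlap n L K heK (hscale A hsA) (hscale B hsB) (hR.inRange _ _ hsubA)
        (hR.inRange _ _ hsubB) hrA hrB hzA hzB

end Adm

section Count

open scoped Classical

/-- **THE (GM) MULTIPLICITY OF A TAGGED GENEALOGY FROM ITS ZONE READING.**  For `G : Gen ε` well-formed,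
chronological for `step ∘ sh`, with kind-`0` birth shapes and non-kind-`0` merger shapes, events in `E`, read by
`ZoneReadingS sh n L K Cb G zone` (`Cb ≥ 0`), and `0 ≤ σ < 1` with `1∕L ≤ σ²`: the zone-admissible torus placements of
`grestrict E G hE` (extents `extRS`) with the root piece at `c` number at most
`Kz^{#merges G}·(∏_{e ∈ merges G} Q(wcntS sh G,σ,(sh e).step)^(d:ℝ))·(L^d)^{partnerAges (step∘sh) G}`,
`Kz = 2^d(C₀ + 2∕(1−σ²) + 1)^d`, `C₀ = max Cb (1∕(1−σ²)+1)` — the socket's `mult(G)` (R-OWNER-22-1 R2). [folklore] -/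
theorem card_admZSet_le_of_readingS (W : ε → ℕ) (n : ℕ) {L : ℕ} (hL : 1 ≤ L) (K : ℕ) {Cb σ : ℝ} (hCb : 0 ≤ Cb)
    (h0 : 0 ≤ σ) (h1 : σ < 1) (hσL : 1 / (L : ℝ) ≤ σ ^ 2) {G : Gen ε} (hW : G.WF W)
    (hchr : Chrono (PEv.step ∘ sh) G) (hk0 : ∀ b ∈ births G, (sh b).kind = 0)
    (hk2 : ∀ m ∈ merges G, (sh m).kind ≠ 0) {zone : ℕ → Gen ε → Finset (Fin d → ℕ)}
    (hR : ZoneReadingS sh n L K Cb G zone) (E : Finset ε) (hE : G.events ⊆ E) (c c₀' : TCell d (n * L ^ K)) :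
    ((admZSet (nearT n L K) (fun t Z => extRS sh n L K G zone t (gmap Subtype.val Z))
        ((PEv.step ∘ sh) ∘ Subtype.val) (grestrict E G hE) (grestrict E G hE).root c c₀').card : ℝ) ≤
      ((2 : ℝ) ^ d * (max Cb (1 / (1 - σ ^ 2) + 1) + 2 * (1 / (1 - σ ^ 2)) + 1) ^ d) ^ (merges G).card *
        (∏ e ∈ merges G, Q (wcntS sh G) σ (sh e).step ^ (d : ℝ)) *
          ((L : ℝ) ^ d) ^ partnerAges (PEv.step ∘ sh) G :=
  card_admZSet_grestrict_le_of_dynS sh W n hL K (extRS sh n L K G zone) (extRS_nonneg sh n L K G zone) h0 h1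
    (zoneDyn_of_readingS sh hL hCb hσL hchr hR) hW hchr hk0 hk2 E hE c c₀'

end Count

end

end Summit.QuantumFields.BalabanUV.T4Continuum.HistoryZones
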